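import Literature.AlgebraicGeometry.Resolution.TameQuotientSingularitiesResolution
import Summits.ResolutionOfSingularities.ResolutionOfSingularities.Theorems.WildQuotientsTameQuotientResolution
import HarnessLib

/-!
# Resolution of diagonalizable quotient singularities over a perfect field, modulo Bergh–Rydh
(crux `FrobeniusLadder.FRationalResolution`, line `Sketch`)

Stub `diagonalizableQuotientResolution_of_perfectField` of the skeleton `Sketch` for crux
stmt-ResolutionOfSingularities-15317. The line `redirect` cuts rung 4′ into an lrq-ification step
and the resolution of DIAGONALIZABLE quotient singularities, the latter stated for every field with
REGULAR charts: every point of the integral separated finite-type `k`-scheme `X` lies in the image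
of an étale `k`-morphism `Spec S₀ → X`, where `S` is a regular finitely generated `k`-algebra
graded by a finite abelian group `A` (`Spec S₀ = Spec S / D(A)`). Over a PERFECT field `k` a
regular finitely generated `k`-algebra is smooth over `k`
(`algebraSmooth_of_isRegularRing_of_perfectField`, Matsumura §30 Rem. 2), so the statement is
exactly the named fact `BerghRydh2019_diagonalizableQuotientResolution` (Bergh–Rydh 2019, Thm. 5,
diagonalizable case), whose charts are phrased with `Algebra.Smooth k S`. This file records that
discharge; the theorem is conditional on the named fact, taken as the hypothesis `hBR`.
-/

set_option linter.dupNamespace false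

noncomputable section

open CategoryTheory AlgebraicGeometry TopologicalSpace Literature.AlgebraicGeometry.Resolution

namespace Summit.ResolutionOfSingularities.ResolutionOfSingularities.Theorems.FRationalResolution

/-- **Resolution of diagonalizable quotient singularities over a perfect field, modulo
Bergh–Rydh 2019 Thm. 5.** Assuming the named fact
`BerghRydh2019_diagonalizableQuotientResolution`: if `k` is perfect and `X` is an integral
separated `k`-scheme of finite type every point of which lies in the image of an étale
`k`-morphism `Spec S₀ → X`, where `S` is a REGULAR finitely generated `k`-algebra graded by a
finite abelian group `A` and `S₀ = 𝒮 0` is its degree-zero part, then `X` has a resolution of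
singularities. (Regular + finite type over the perfect `k` ⇒ smooth over `k`, by
`algebraSmooth_of_isRegularRing_of_perfectField`; then apply `hBR`.)
[cite: BerghRydh2019, Thm 5 (arXiv:1905.00872, p. 4)] -/
theorem diagonalizableQuotientResolution_of_perfectField
    (hBR : BerghRydh2019_diagonalizableQuotientResolution)
    (k : Type) [Field k] [PerfectField k] (X : Scheme.{0}) (g : X ⟶ Spec (.of k))
    [IsIntegral X] [IsSeparated g] [LocallyOfFiniteType g] [QuasiCompact g]
    (hq : ∀ x : X, ∃ (A : Type) (_ : AddCommGroup A) (_ : Finite A) (_ : DecidableEq A)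
        (S : Type) (_ : CommRing S) (_ : Algebra k S) (𝒮 : A → Submodule k S)
        (_ : GradedAlgebra 𝒮), Algebra.FiniteType k S ∧ IsRegularRing S ∧
        ∃ φ : Spec (.of (𝒮 0)) ⟶ X, Etale φ ∧ x ∈ Set.range φ ∧
          φ ≫ g = Spec.map (CommRingCat.ofHom (algebraMap k (𝒮 0)))) :
    Scheme.HasResolution X := by
  refine hBR k X g fun x => ?_
  obtain ⟨A, _, _, _, S, _, _, 𝒮, _, hft, hreg, φ, hφ, hx, hcomp⟩ := hq x
  haveI := hft; haveI := hreg
  exact ⟨A, inferInstance, inferInstance, inferInstance, S, inferInstance, inferInstance, 𝒮,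
    inferInstance, hft, algebraSmooth_of_isRegularRing_of_perfectField k S, φ, hφ, hx, hcomp⟩

end Summit.ResolutionOfSingularities.ResolutionOfSingularities.Theorems.FRationalResolution

end
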